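import Summits.AtomisticToContinuum.Crystallization.Theorems.ReggeStarCoercivityDefectFreeCrystallizesExactFrameC01

/-!
# Exact stars at a c-type site give an exact frame, II (stub `stub_exactFrameC`, X2b of line `palm-good-law`,
# crux `ReggeStarCoercivity.DefectFreeCrystallizes`, stmt-AtomisticToContinuum-13603; part 2 of 2 — proves the
# registered stub)

Let `s` be a Hägg word, `X : ℤ³ → ℝ³` an injective CHART of a configuration against the ideal stacking
`barlowStacking 1 √(2/3) s` (ideal contacts `dist = 1` ↔ pairs at distance in `(0, 6/5)`), and `u` a c-type
site (`s (u.1 − 1) = s u.1`).  If the root star of the configuration re-rooted at `X u` is EXACT — congruence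
defect `0` against the relaxed hcp star `hcpSite a₀ h₀` OR against the regular cuboctahedron
`a₀ • fccKissingPattern` — and the annulus `11/10 < ‖y‖ ≤ 5/4` is empty, then ONE linear isometry `A` carries
the relaxed struts `barlowPos a₀ (a₀ √(2/3)) s w − barlowPos a₀ (a₀ √(2/3)) s u` of the twelve contacts `w` of
`u` onto `X w − X u` (`stub_exactFrameC`).  With the label set `I`, the labelled neighbour map `N` and the metric
form `Q` of part 1 (variables with defining equations `hI`, `hN`, `hQ`; `dist_eq_one_iff_nbrC`):

* `rootStar_eqC`: by the chart and the empty annulus the root star is the labelled twelve-point set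
  `{X (N ε) − X u : ε ∈ I}`;
* `hcp_branch_falseC`: a vanishing defect against the relaxed hcp star is attained
  (`stub_localCongruenceExactStar`); through the chart (relaxed contacts `≤ 1 < 6/5`) the induced labelling is
  an injective contact-graph homomorphism of the hcp star into the cuboctahedral link of `u`, impossible by the
  TYPE GAP the other way round: the edge `{(0,1,0), (0,0,1)}` of the hcp star lies in two triangles
  (`ideal_edge_two_triangles`), every edge of the cuboctahedral link in one (`c_edge_one_triangle`);
* `fcc_branch_frameC`: a vanishing defect against `a₀ • fccKissingPattern` is attained
  (`exactCopy_of_iInf_eq_zero`); the induced labelling `Φ : I → fccInt` is a contact-graph ISOMORPHISM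
  (chart: contacts `a₀ < 6/5`, pattern distances `1` or `≥ √2`), hence carries the whole distance table
  (`six_mul_sqNormInt_eq`): the naturally labelled star has the metric of the relaxed reference star
  (`twelve_mul_dist_sq_nbrC`), and the frame is read off three independent struts
  (`exists_linearIsometry_of_inner_eq`, `linearIndependent_strutsC`).

All `[folklore]`.
-/

noncomputable section

open scoped BigOperators
open MeasureTheory

namespace Summit.AtomisticToContinuum.Crystallization.Theorems.PalmGoodLaw.ExactFrameC

open Literature.MathematicalPhysics.StatisticalMechanics Literature.Geometry.DiscreteGeometry
open Literature.Probability.Process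
open Summit.AtomisticToContinuum.Crystallization.Theorems.PalmUnimodularRigidity.LayeredLawsSelectHcp
open Summit.AtomisticToContinuum.Crystallization.Theorems.PalmGoodLaw.ExactFrameH
open scoped RealInnerProductSpace

section Chart

variable {I : Finset (ℤ × ℤ × ℤ)} {Q : ℤ × ℤ × ℤ → ℤ × ℤ × ℤ → ℤ} {a₀ h₀ : ℝ} {s : ℤ → ℤ}
  {X : ℤ × ℤ × ℤ → EuclideanSpace ℝ (Fin 3)} {u : ℤ × ℤ × ℤ} {N : ℤ × ℤ × ℤ → ℤ × ℤ × ℤ}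

/-! ## The root star of the re-rooted configuration -/

/-- **The root star of the configuration re-rooted at `X u` is the labelled image of the twelve contacts of
`u`** (c-type site): contacts are atoms at distance in `(0, 6/5)` (chart), the annulus `(11/10, 5/4]` is
empty, and the atoms of `count|T` are the points of `T`. [folklore] -/
theorem rootStar_eqC (hI : I = {(0, 1, 0), (0, -1, 0), (0, 0, 1), (0, 0, -1), (0, 1, -1), (0, -1, 1),
      (1, 0, 0), (1, -1, 0), (1, 0, -1), (-1, 0, 0), (-1, 1, 0), (-1, 0, 1)})
    (hs : IsHaggSeq s) (hu : s (u.1 - 1) = s u.1)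
    (hN : ∀ ε, N ε = (u.1 + ε.1, u.2.1 + s u.1 * ε.2.1, u.2.2 + s u.1 * ε.2.2))
    (hchart : ∀ u w : ℤ × ℤ × ℤ, dist (barlowPos 1 (Real.sqrt (2 / 3)) s u.1 u.2.1 u.2.2)
      (barlowPos 1 (Real.sqrt (2 / 3)) s w.1 w.2.1 w.2.2) = 1 ↔ (0 < dist (X u) (X w) ∧ dist (X u) (X w) < 6 / 5))
    (hann : (Measure.count : Measure (EuclideanSpace ℝ (Fin 3))).restrict
      ((fun z : EuclideanSpace ℝ (Fin 3) => z - X u) '' Set.range X)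
      {y : EuclideanSpace ℝ (Fin 3) | 11 / 10 < ‖y‖ ∧ ‖y‖ ≤ 5 / 4} = 0) :
    rootStar ((Measure.count : Measure (EuclideanSpace ℝ (Fin 3))).restrict
        ((fun z : EuclideanSpace ℝ (Fin 3) => z - X u) '' Set.range X)) =
      ↑(I.image fun ε => X (N ε) - X u) := by
  -- no atom in the annulus
  have hgap : ∀ w, ¬ (11 / 10 < ‖X w - X u‖ ∧ ‖X w - X u‖ ≤ 5 / 4) := by
    intro w hw
    have hle := Measure.le_restrict_apply (μ := (Measure.count : Measure (EuclideanSpace ℝ (Fin 3))))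
      ((fun z : EuclideanSpace ℝ (Fin 3) => z - X u) '' Set.range X)
      {y : EuclideanSpace ℝ (Fin 3) | 11 / 10 < ‖y‖ ∧ ‖y‖ ≤ 5 / 4}
    rw [hann, nonpos_iff_eq_zero, Measure.count_eq_zero_iff, Set.eq_empty_iff_forall_notMem] at hle
    exact hle (X w - X u) ⟨hw, X w, ⟨w, rfl⟩, rfl⟩
  ext y
  simp only [rootStar, Set.mem_setOf_eq, count_restrict_singleton_ne_zero_iff, Set.mem_image,
    Set.mem_range, exists_exists_eq_and, Finset.coe_image, Finset.mem_coe]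
  constructor
  · rintro ⟨⟨w, rfl⟩, hpos, hle⟩
    have hd : 0 < dist (X u) (X w) ∧ dist (X u) (X w) < 6 / 5 := by
      rw [dist_comm, dist_eq_norm]; exact ⟨hpos, by linarith⟩
    obtain ⟨ε, hε, rfl⟩ := (dist_eq_one_iff_nbrC hI hs hu hN w).1 ((hchart u w).2 hd)
    exact ⟨ε, hε, rfl⟩
  · rintro ⟨ε, hε, rfl⟩
    have h1 := (dist_eq_one_iff_nbrC hI hs hu hN (N ε)).2 ⟨ε, hε, rfl⟩
    obtain ⟨hpos, hlt⟩ := (hchart u _).1 h1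
    rw [dist_comm, dist_eq_norm] at hpos hlt
    refine ⟨⟨_, rfl⟩, hpos, ?_⟩
    by_contra hgt
    exact hgap _ ⟨not_le.1 hgt, by linarith⟩

/-! ## The hcp branch is impossible at a c-type site -/

/-- **No exact hcp star at a c-type site.** If the congruence defect of the labelled twelve-point star
`{X (N ε) − X u}` against the relaxed hcp star `hcpSite a₀ h₀` vanished, an exact copy
(`stub_localCongruenceExactStar`) would label the star by `hcpStarIdx`, injectively; through the chart
(relaxed hcp contacts are `≤ 1 < 6/5` apart, `star_dist_le_one`) ideal hcp-star contacts would become contacts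
of the cuboctahedral link of `u` — but the edge `{(0,1,0), (0,0,1)}` of the hcp star lies in two triangles
and every edge of the cuboctahedral link in one (`c_edge_one_triangle`). [folklore] -/
theorem hcp_branch_falseC (hI : I = {(0, 1, 0), (0, -1, 0), (0, 0, 1), (0, 0, -1), (0, 1, -1), (0, -1, 1),
      (1, 0, 0), (1, -1, 0), (1, 0, -1), (-1, 0, 0), (-1, 1, 0), (-1, 0, 1)})
    (hQ : Q = fun e f => 3 * (2 * (e.2.1 - f.2.1) + (e.2.2 - f.2.2) + (e.1 - f.1)) ^ 2 +
      (3 * (e.2.2 - f.2.2) + (e.1 - f.1)) ^ 2 + 8 * (e.1 - f.1) ^ 2)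
    (ha₁ : 189 / 200 ≤ a₀) (ha₂ : a₀ ≤ 199 / 200) (hh₁ : 77 / 100 ≤ h₀) (hh₂ : h₀ ≤ 163 / 200)
    (hs : IsHaggSeq s)
    (hN : ∀ ε, N ε = (u.1 + ε.1, u.2.1 + s u.1 * ε.2.1, u.2.2 + s u.1 * ε.2.2))
    (hchart : ∀ u w : ℤ × ℤ × ℤ, dist (barlowPos 1 (Real.sqrt (2 / 3)) s u.1 u.2.1 u.2.2)
      (barlowPos 1 (Real.sqrt (2 / 3)) s w.1 w.2.1 w.2.2) = 1 ↔ (0 < dist (X u) (X w) ∧ dist (X u) (X w) < 6 / 5))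
    (hu : s (u.1 - 1) = s u.1)
    (hdef : (⨅ A : EuclideanSpace ℝ (Fin 3) ≃ₗᵢ[ℝ] EuclideanSpace ℝ (Fin 3), ∑ v ∈ hcpStarIdx,
      Metric.infDist (A (hcpSite a₀ h₀ v)) ↑(I.image fun ε => X (N ε) - X u) ^ 2) = 0) :
    False := by
  set ZF : Finset (EuclideanSpace ℝ (Fin 3)) := I.image (fun ε => X (N ε) - X u) with hZF
  have hZne : ZF.Nonempty := Finset.image_nonempty.2 ⟨(0, 1, 0), by rw [hI]; decide⟩
  obtain ⟨g, hgZ, -, hgd⟩ := stub_localCongruenceExactStar a₀ h₀ ZF hZne hdef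
  -- the induced labelling `ψ : hcpStarIdx → I`
  have hlab : ∀ δ ∈ hcpStarIdx, ∃ ε ∈ I, X (N ε) - X u = g δ := fun δ hδ => by
    have := hgZ δ hδ
    rw [hZF, Finset.mem_image] at this
    exact this
  choose! ψ hψmem hψeq using hlab
  have hgne : ∀ δ ∈ hcpStarIdx, ∀ δ' ∈ hcpStarIdx, δ ≠ δ' → 0 < dist (g δ) (g δ') := by
    intro δ hδ δ' hδ' hne
    rw [hgd δ hδ δ' hδ']
    by_cases h1 : dist (hcpSite 1 (Real.sqrt (2 / 3)) δ) (hcpSite 1 (Real.sqrt (2 / 3)) δ') = 1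
    · exact (star_dist_le_one ha₁ ha₂ hh₁ hh₂ hδ hδ' h1).1
    · linarith [star_dist_gt ha₁ hh₁ hδ hδ' hne h1]
  have hinj : Set.InjOn ψ ↑hcpStarIdx := by
    intro δ hδ δ' hδ' heq
    by_contra hne
    have := hgne δ hδ δ' hδ' hne
    rw [← hψeq δ hδ, ← hψeq δ' hδ', heq, dist_self] at this
    exact lt_irrefl _ this
  -- ideal hcp-star contacts become contacts of the cuboctahedral link
  have hadj : ∀ δ ∈ hcpStarIdx, ∀ δ' ∈ hcpStarIdx,
      dist (hcpSite 1 (Real.sqrt (2 / 3)) δ) (hcpSite 1 (Real.sqrt (2 / 3)) δ') = 1 → ψ δ - ψ δ' ∈ I := by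
    intro δ hδ δ' hδ' h1
    obtain ⟨hpos, hle⟩ := star_dist_le_one ha₁ ha₂ hh₁ hh₂ hδ hδ' h1
    have hc : 0 < dist (X (N (ψ δ))) (X (N (ψ δ'))) ∧ dist (X (N (ψ δ))) (X (N (ψ δ'))) < 6 / 5 := by
      rw [← dist_sub_right _ _ (X u), hψeq δ hδ, hψeq δ' hδ', hgd δ hδ δ' hδ']
      exact ⟨hpos, by linarith⟩
    exact (dist_nbrC_eq_one_iff hI hQ hs hu hN (hψmem δ hδ) (hψmem δ' hδ')).1
      ((hchart (N (ψ δ)) (N (ψ δ'))).2 hc)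
  -- the type gap
  obtain ⟨d01, d02, d12, d03, d13⟩ := ideal_edge_two_triangles
  have m0 : ((0, 1, 0) : ℤ × ℤ × ℤ) ∈ hcpStarIdx := by decide
  have m1 : ((0, 0, 1) : ℤ × ℤ × ℤ) ∈ hcpStarIdx := by decide
  have m2 : ((1, 0, 0) : ℤ × ℤ × ℤ) ∈ hcpStarIdx := by decide
  have m3 : ((-1, 0, 0) : ℤ × ℤ × ℤ) ∈ hcpStarIdx := by decide
  have hone := c_edge_one_triangle hI _ (hψmem _ m0) _ (hψmem _ m1) (hadj _ m0 _ m1 d01)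
  have hr : ψ (1, 0, 0) ∈ I.filter fun r => ψ (0, 1, 0) - r ∈ I ∧ ψ (0, 0, 1) - r ∈ I :=
    Finset.mem_filter.2 ⟨hψmem _ m2, hadj _ m0 _ m2 d02, hadj _ m1 _ m2 d12⟩
  have ht : ψ (-1, 0, 0) ∈ I.filter fun r => ψ (0, 1, 0) - r ∈ I ∧ ψ (0, 0, 1) - r ∈ I :=
    Finset.mem_filter.2 ⟨hψmem _ m3, hadj _ m0 _ m3 d03, hadj _ m1 _ m3 d13⟩
  exact absurd (hinj m2 m3 (Finset.card_le_one.1 hone.le _ hr _ ht)) (by decide)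

/-! ## The fcc branch: the labelled exact star and its frame -/

/-- **Labelled exact star at a c-type site.**  If the congruence defect of the labelled star
`{X (N ε) − X u}` against the cuboctahedron `a₀ • fccKissingPattern` vanishes, a linear isometry `A` carries
the relaxed struts of `u` (spacings `(a₀, a₀ √(2/3))`) onto it LABEL BY LABEL.  The exact copy
(`exactCopy_of_iInf_eq_zero`) labels the star atoms by `fccInt`; through the chart the labelling
`Φ : I → fccInt` is a bijection with `ε − ε' ∈ I ↔ |Φ ε − Φ ε'|² = 2` (contacts are `a₀ < 6/5` apart, pattern
distances are `1` or `≥ √2`), so it carries the whole distance table (`six_mul_sqNormInt_eq`); the naturally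
labelled star then has the lengths and mutual distances of the relaxed struts (`twelve_mul_dist_sq_nbrC`),
hence their Gram data, and `A` is read off three independent struts. [folklore] -/
theorem fcc_branch_frameC (hI : I = {(0, 1, 0), (0, -1, 0), (0, 0, 1), (0, 0, -1), (0, 1, -1), (0, -1, 1),
      (1, 0, 0), (1, -1, 0), (1, 0, -1), (-1, 0, 0), (-1, 1, 0), (-1, 0, 1)})
    (hQ : Q = fun e f => 3 * (2 * (e.2.1 - f.2.1) + (e.2.2 - f.2.2) + (e.1 - f.1)) ^ 2 +
      (3 * (e.2.2 - f.2.2) + (e.1 - f.1)) ^ 2 + 8 * (e.1 - f.1) ^ 2)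
    (ha₁ : 189 / 200 ≤ a₀) (ha₂ : a₀ ≤ 199 / 200) (hs : IsHaggSeq s) (hX : Function.Injective X)
    (hN : ∀ ε, N ε = (u.1 + ε.1, u.2.1 + s u.1 * ε.2.1, u.2.2 + s u.1 * ε.2.2))
    (hchart : ∀ u w : ℤ × ℤ × ℤ, dist (barlowPos 1 (Real.sqrt (2 / 3)) s u.1 u.2.1 u.2.2)
      (barlowPos 1 (Real.sqrt (2 / 3)) s w.1 w.2.1 w.2.2) = 1 ↔ (0 < dist (X u) (X w) ∧ dist (X u) (X w) < 6 / 5))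
    (hu : s (u.1 - 1) = s u.1)
    (hfcc : (⨅ A : EuclideanSpace ℝ (Fin 3) ≃ₗᵢ[ℝ] EuclideanSpace ℝ (Fin 3), ∑ p ∈ fccKissingPattern,
      Metric.infDist (A (a₀ • p)) ↑(I.image fun ε => X (N ε) - X u) ^ 2) = 0) :
    ∃ A : EuclideanSpace ℝ (Fin 3) ≃ₗᵢ[ℝ] EuclideanSpace ℝ (Fin 3), ∀ ε ∈ I,
      X (N ε) - X u = A (barlowPos a₀ (a₀ * Real.sqrt (2 / 3)) s (N ε).1 (N ε).2.1 (N ε).2.2 -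
        barlowPos a₀ (a₀ * Real.sqrt (2 / 3)) s u.1 u.2.1 u.2.2) := by
  have ha0 : 0 < a₀ := by linarith
  obtain ⟨R, hR⟩ : ∃ R : ℤ × ℤ × ℤ → EuclideanSpace ℝ (Fin 3), ∀ ε, R ε =
      barlowPos a₀ (a₀ * Real.sqrt (2 / 3)) s (N ε).1 (N ε).2.1 (N ε).2.2 -
        barlowPos a₀ (a₀ * Real.sqrt (2 / 3)) s u.1 u.2.1 u.2.2 := ⟨_, fun _ => rfl⟩
  set ZF : Finset (EuclideanSpace ℝ (Fin 3)) := I.image (fun ε => X (N ε) - X u) with hZF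
  have hZne : ZF.Nonempty := Finset.image_nonempty.2 ⟨(0, 1, 0), by rw [hI]; decide⟩
  obtain ⟨g, hgZ, hgn, hgd⟩ := exactCopy_of_iInf_eq_zero fccKissingPattern (fun p => a₀ • p) ZF hZne hfcc
  have hgd' : ∀ p ∈ fccKissingPattern, ∀ q ∈ fccKissingPattern, dist (g p) (g q) = a₀ * dist p q := by
    intro p hp q hq
    rw [hgd p hp q hq, dist_smul₀, Real.norm_of_nonneg ha0.le]
  have hgn' : ∀ p ∈ fccKissingPattern, ‖g p‖ = a₀ := by
    intro p hp
    rw [hgn p hp, norm_smul, Real.norm_of_nonneg ha0.le, norm_eq_one_of_mem_fccKissingPattern hp, mul_one]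
  have hginj : Set.InjOn g ↑fccKissingPattern := by
    intro p hp q hq hpq
    by_contra hne
    have h1 := one_le_dist_of_mem_fccKissingPattern hp hq hne
    have h0 : dist (g p) (g q) = 0 := by rw [hpq, dist_self]
    rw [hgd' p hp q hq] at h0
    nlinarith
  have hcardZ : ZF.card ≤ fccKissingPattern.card := by
    rw [card_fccKissingPattern]
    exact Finset.card_image_le.trans (by rw [card_cIdx hI])
  have hsurj : Set.SurjOn g ↑fccKissingPattern ↑ZF :=
    Finset.surjOn_of_injOn_of_card_le g (fun p hp => hgZ p hp) hginj hcardZ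
  -- integer labels of the star atoms
  have hlab : ∀ ε ∈ I, ∃ v ∈ fccInt,
      g ((Real.sqrt (2 : ℕ))⁻¹ • intVec v) = X (N ε) - X u := by
    intro ε hε
    have hmem : X (N ε) - X u ∈ (↑ZF : Set (EuclideanSpace ℝ (Fin 3))) :=
      Finset.mem_coe.2 (Finset.mem_image_of_mem _ hε)
    obtain ⟨p, hp, hpe⟩ := hsurj hmem
    obtain ⟨v, hv, rfl⟩ := Finset.mem_image.1 hp
    exact ⟨v, hv, hpe⟩
  choose! Φ hΦI hΦeq using hlab
  have hΦP : ∀ ε ∈ I,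
      ((Real.sqrt (2 : ℕ))⁻¹ • intVec (Φ ε) : EuclideanSpace ℝ (Fin 3)) ∈ fccKissingPattern :=
    fun ε hε => Finset.mem_image_of_mem _ (hΦI ε hε)
  have hΦinj : Set.InjOn Φ ↑I := by
    intro ε hε ε' hε' h
    have h2 : X (N ε) - X u = X (N ε') - X u := by rw [← hΦeq ε hε, ← hΦeq ε' hε', h]
    exact nbr_injective hs hN (hX (sub_left_inj.1 h2))
  have hΦmaps : Set.MapsTo Φ ↑I ↑fccInt := fun ε hε => hΦI ε hε
  have hΦsurj : Set.SurjOn Φ ↑I ↑fccInt :=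
    Finset.surjOn_of_injOn_of_card_le Φ hΦmaps hΦinj (by rw [card_fccInt, card_cIdx hI])
  -- distances of star atoms through the integer labels
  have hdist : ∀ ε ∈ I, ∀ ε' ∈ I, dist (X (N ε)) (X (N ε')) =
      a₀ * dist ((Real.sqrt (2 : ℕ))⁻¹ • intVec (Φ ε) : EuclideanSpace ℝ (Fin 3))
        ((Real.sqrt (2 : ℕ))⁻¹ • intVec (Φ ε')) := by
    intro ε hε ε' hε'
    rw [← dist_sub_right _ _ (X u), ← hΦeq ε hε, ← hΦeq ε' hε', hgd' _ (hΦP ε hε) _ (hΦP ε' hε')]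
  -- the labelling is a contact-graph isomorphism
  have hadj : ∀ ε ∈ I, ∀ ε' ∈ I, (ε - ε' ∈ I ↔ sqNormInt (Φ ε - Φ ε') = 2) := by
    intro ε hε ε' hε'
    constructor
    · intro hq
      have h1 := (dist_nbrC_eq_one_iff hI hQ hs hu hN hε hε').2 hq
      obtain ⟨hpos, hlt⟩ := (hchart (N ε) (N ε')).1 h1
      rw [hdist ε hε ε' hε'] at hpos hlt
      have hne : ((Real.sqrt (2 : ℕ))⁻¹ • intVec (Φ ε) : EuclideanSpace ℝ (Fin 3)) ≠
          (Real.sqrt (2 : ℕ))⁻¹ • intVec (Φ ε') := by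
        intro h
        rw [h, dist_self, mul_zero] at hpos
        exact lt_irrefl _ hpos
      have h127 : dist ((Real.sqrt (2 : ℕ))⁻¹ • intVec (Φ ε) : EuclideanSpace ℝ (Fin 3))
          ((Real.sqrt (2 : ℕ))⁻¹ • intVec (Φ ε')) < 127 / 100 := by
        by_contra hge
        rw [not_lt] at hge
        have := mul_le_mul_of_nonneg_left hge ha0.le
        linarith
      have hd1 := fcc_dist_eq_one _ (hΦP ε hε) _ (hΦP ε' hε') hne
        (h127.trans (by rw [Real.lt_sqrt (by norm_num)]; norm_num))
      exact_mod_cast sqNormInt_eq_of_dist_eq_one two_ne_zero hd1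
    · intro h2
      have hd1 : dist ((Real.sqrt (2 : ℕ))⁻¹ • intVec (Φ ε) : EuclideanSpace ℝ (Fin 3))
          ((Real.sqrt (2 : ℕ))⁻¹ • intVec (Φ ε')) = 1 := by
        have hsq := dist_sq_scaledPattern two_ne_zero (Φ ε) (Φ ε')
        rw [h2] at hsq
        push_cast at hsq
        rw [div_self (two_ne_zero' ℝ)] at hsq
        rwa [pow_eq_one_iff_of_nonneg dist_nonneg two_ne_zero] at hsq
      refine (dist_nbrC_eq_one_iff hI hQ hs hu hN hε hε').1 ((hchart (N ε) (N ε')).2 ?_)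
      rw [hdist ε hε ε' hε', hd1, mul_one]
      exact ⟨ha0, by linarith⟩
  have hmetric := six_mul_sqNormInt_eq hI hQ hΦinj hΦmaps hΦsurj hadj
  -- the naturally labelled star has the metric of the relaxed reference star
  have h23 : (a₀ * Real.sqrt (2 / 3)) ^ 2 = 2 / 3 * a₀ ^ 2 := by
    rw [mul_pow, Real.sq_sqrt (by norm_num)]; ring
  have hzd : ∀ ε ∈ I, ∀ ε' ∈ I, dist (X (N ε) - X u) (X (N ε') - X u) = dist (R ε) (R ε') := by
    intro ε hε ε' hε'
    have hm : ((sqNormInt (Φ ε - Φ ε') : ℤ) : ℝ) = (Q ε ε' : ℝ) / 6 := by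
      have h6 : ((6 * sqNormInt (Φ ε - Φ ε') : ℤ) : ℝ) = (Q ε ε' : ℝ) := by
        exact_mod_cast hmetric ε hε ε' hε'
      push_cast at h6
      linarith
    have hl : dist (X (N ε) - X u) (X (N ε') - X u) ^ 2 = a₀ ^ 2 * (Q ε ε' : ℝ) / 12 := by
      rw [dist_sub_right, hdist ε hε ε' hε', mul_pow, dist_sq_scaledPattern two_ne_zero, hm]
      push_cast
      ring
    have hr : dist (R ε) (R ε') ^ 2 = a₀ ^ 2 * (Q ε ε' : ℝ) / 12 := by
      rw [hR, hR, dist_sub_right]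
      have := twelve_mul_dist_sq_nbrC hQ hs hu hN h23 (cIdx_fst_cases hI ε hε) (cIdx_fst_cases hI ε' hε')
      linarith
    exact (sq_eq_sq₀ dist_nonneg dist_nonneg).1 (hl.trans hr.symm)
  have hzn : ∀ ε ∈ I, ‖X (N ε) - X u‖ = ‖R ε‖ := by
    intro ε hε
    rw [← hΦeq ε hε, hgn' _ (hΦP ε hε), hR, norm_strutC hI hQ hs hu hN ha0.le h23 hε]
  have hinner : ∀ ε ∈ I, ∀ ε' ∈ I, ⟪R ε, R ε'⟫ = ⟪X (N ε) - X u, X (N ε') - X u⟫ :=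
    fun ε hε ε' hε' =>
      inner_eq_of_norm_eq_of_dist_eq (hzn ε hε).symm (hzn ε' hε').symm (hzd ε hε ε' hε').symm
  -- a linear isometry from three independent struts
  have hh0 : a₀ * Real.sqrt (2 / 3) ≠ 0 := by positivity
  have m0 : ((0, 1, 0) : ℤ × ℤ × ℤ) ∈ I := by rw [hI]; decide
  have m1 : ((0, 0, 1) : ℤ × ℤ × ℤ) ∈ I := by rw [hI]; decide
  have m2 : ((1, 0, 0) : ℤ × ℤ × ℤ) ∈ I := by rw [hI]; decide
  set p : Fin 3 → EuclideanSpace ℝ (Fin 3) := ![R (0, 1, 0), R (0, 0, 1), R (1, 0, 0)] with hp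
  set q : Fin 3 → EuclideanSpace ℝ (Fin 3) :=
    ![X (N (0, 1, 0)) - X u, X (N (0, 0, 1)) - X u, X (N (1, 0, 0)) - X u] with hq
  have hli : LinearIndependent ℝ p := by
    have h := linearIndependent_strutsC hs hu hN ha0.ne' hh0
    rw [← hR, ← hR, ← hR] at h
    exact h
  have hpq : ∀ i j, ⟪p i, p j⟫ = ⟪q i, q j⟫ := by
    intro i j
    fin_cases i <;> fin_cases j <;>
      simp only [hp, hq, Fin.zero_eta, Fin.mk_one, Fin.reduceFinMk, Matrix.cons_val_zero,
        Matrix.cons_val_one, Matrix.cons_val] <;> apply hinner <;> assumption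
  obtain ⟨A₀, hA₀⟩ := exists_linearIsometry_of_inner_eq hli hpq
  set A : EuclideanSpace ℝ (Fin 3) ≃ₗᵢ[ℝ] EuclideanSpace ℝ (Fin 3) := A₀.toLinearIsometryEquiv rfl with hA
  have hAp : ∀ i, A (p i) = q i := fun i => by rw [hA, LinearIsometry.coe_toLinearIsometryEquiv]; exact hA₀ i
  have hlq : LinearIndependent ℝ q := by
    have h := hli.map' A.toLinearEquiv.toLinearMap A.toLinearEquiv.ker
    have hfun : ⇑A.toLinearEquiv.toLinearMap ∘ p = q := by
      funext i; exact hAp i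
    rw [hfun] at h
    exact h
  refine ⟨A, fun ε hε => ?_⟩
  rw [← hR]
  symm
  rw [← sub_eq_zero]
  refine eq_zero_of_inner_linearIndependent_fin_three hlq fun i => ?_
  rw [inner_sub_left, sub_eq_zero, ← hAp i, A.inner_map_map, hAp i]
  fin_cases i
  · simpa [hp, hq] using hinner ε hε _ m0
  · simpa [hp, hq] using hinner ε hε _ m1
  · simpa [hp, hq] using hinner ε hε _ m2

end Chart

/-! ## The registered stub -/

/-- **Stub `stub_exactFrameC` (X2b of line `palm-good-law`): exact stars at a c-type site give an exact
frame.**  For a Hägg word `s`, an injective chart `X : ℤ³ → ℝ³` against the ideal stacking (ideal contacts ↔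
pairs at distance in `(0, 6/5)`), and a c-type site `u` (`s (u.1 − 1) = s u.1`) whose re-rooted root star is
exact (defect `0` against the relaxed hcp star OR against `a₀ • fccKissingPattern`) with empty annulus
`(11/10, 5/4]`, one linear isometry `A` gives
`X w − X u = A (barlowPos a₀ (a₀ √(2/3)) s w − barlowPos a₀ (a₀ √(2/3)) s u)` for all contacts `w` of `u`.
The root star is the labelled image of the twelve contacts (`rootStar_eqC`); the hcp branch is impossible
(`hcp_branch_falseC`, type gap); in the fcc branch `fcc_branch_frameC` gives `A` on the relaxed struts of the
labelled contacts, which are all the contacts (`dist_eq_one_iff_nbrC`). [folklore] -/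
theorem stub_exactFrameC :
    ∀ a₀ h₀ : ℝ, 189 / 200 ≤ a₀ → a₀ ≤ 199 / 200 → 77 / 100 ≤ h₀ → h₀ ≤ 163 / 200 →
      ∀ s : ℤ → ℤ, IsHaggSeq s →
      ∀ X : ℤ × ℤ × ℤ → EuclideanSpace ℝ (Fin 3), Function.Injective X →
        (∀ u w : ℤ × ℤ × ℤ,
          dist (barlowPos 1 (Real.sqrt (2 / 3)) s u.1 u.2.1 u.2.2) (barlowPos 1 (Real.sqrt (2 / 3)) s w.1 w.2.1 w.2.2) = 1 ↔
            (0 < dist (X u) (X w) ∧ dist (X u) (X w) < 6 / 5)) →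
        ∀ u : ℤ × ℤ × ℤ, s (u.1 - 1) = s u.1 →
          (Summit.AtomisticToContinuum.Crystallization.Theorems.PalmUnimodularRigidity.LayeredLawsSelectHcp.starDefect a₀ h₀
              ((Measure.count : Measure (EuclideanSpace ℝ (Fin 3))).restrict
                ((fun z : EuclideanSpace ℝ (Fin 3) => z - X u) '' Set.range X)) = 0 ∨
            (⨅ A : EuclideanSpace ℝ (Fin 3) ≃ₗᵢ[ℝ] EuclideanSpace ℝ (Fin 3),
              ∑ p ∈ fccKissingPattern, Metric.infDist (A (a₀ • p))
                (Summit.AtomisticToContinuum.Crystallization.Theorems.PalmUnimodularRigidity.LayeredLawsSelectHcp.rootStar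
                  ((Measure.count : Measure (EuclideanSpace ℝ (Fin 3))).restrict
                    ((fun z : EuclideanSpace ℝ (Fin 3) => z - X u) '' Set.range X))) ^ 2) = 0) →
          (Measure.count : Measure (EuclideanSpace ℝ (Fin 3))).restrict
              ((fun z : EuclideanSpace ℝ (Fin 3) => z - X u) '' Set.range X)
              {y : EuclideanSpace ℝ (Fin 3) | 11 / 10 < ‖y‖ ∧ ‖y‖ ≤ 5 / 4} = 0 →
          ∃ A : EuclideanSpace ℝ (Fin 3) ≃ₗᵢ[ℝ] EuclideanSpace ℝ (Fin 3), ∀ w : ℤ × ℤ × ℤ,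
            dist (barlowPos 1 (Real.sqrt (2 / 3)) s u.1 u.2.1 u.2.2) (barlowPos 1 (Real.sqrt (2 / 3)) s w.1 w.2.1 w.2.2) = 1 →
            X w - X u = A (barlowPos a₀ (a₀ * Real.sqrt (2 / 3)) s w.1 w.2.1 w.2.2 -
              barlowPos a₀ (a₀ * Real.sqrt (2 / 3)) s u.1 u.2.1 u.2.2) := by
  intro a₀ h₀ ha₁ ha₂ hh₁ hh₂ s hs X hX hchart u hu hstar hann
  have hN : ∀ ε : ℤ × ℤ × ℤ,
      (fun ε : ℤ × ℤ × ℤ => (u.1 + ε.1, u.2.1 + s u.1 * ε.2.1, u.2.2 + s u.1 * ε.2.2)) ε =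
        (u.1 + ε.1, u.2.1 + s u.1 * ε.2.1, u.2.2 + s u.1 * ε.2.2) := fun _ => rfl
  have hI : ({(0, 1, 0), (0, -1, 0), (0, 0, 1), (0, 0, -1), (0, 1, -1), (0, -1, 1),
      (1, 0, 0), (1, -1, 0), (1, 0, -1), (-1, 0, 0), (-1, 1, 0), (-1, 0, 1)} : Finset (ℤ × ℤ × ℤ)) =
      {(0, 1, 0), (0, -1, 0), (0, 0, 1), (0, 0, -1), (0, 1, -1), (0, -1, 1),
      (1, 0, 0), (1, -1, 0), (1, 0, -1), (-1, 0, 0), (-1, 1, 0), (-1, 0, 1)} := rfl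
  have hQ : (fun e f : ℤ × ℤ × ℤ => 3 * (2 * (e.2.1 - f.2.1) + (e.2.2 - f.2.2) + (e.1 - f.1)) ^ 2 +
      (3 * (e.2.2 - f.2.2) + (e.1 - f.1)) ^ 2 + 8 * (e.1 - f.1) ^ 2) =
      fun e f => 3 * (2 * (e.2.1 - f.2.1) + (e.2.2 - f.2.2) + (e.1 - f.1)) ^ 2 +
      (3 * (e.2.2 - f.2.2) + (e.1 - f.1)) ^ 2 + 8 * (e.1 - f.1) ^ 2 := rfl
  have hZ := rootStar_eqC hI hs hu hN hchart hann
  rcases hstar with hhcp | hfcc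
  · rw [starDefect, hZ] at hhcp
    exact (hcp_branch_falseC hI hQ ha₁ ha₂ hh₁ hh₂ hs hN hchart hu hhcp).elim
  · rw [hZ] at hfcc
    obtain ⟨A, hA⟩ := fcc_branch_frameC hI hQ ha₁ ha₂ hs hX hN hchart hu hfcc
    refine ⟨A, fun w hw => ?_⟩
    obtain ⟨ε, hε, rfl⟩ := (dist_eq_one_iff_nbrC hI hs hu hN w).1 hw
    exact hA ε hε

end Summit.AtomisticToContinuum.Crystallization.Theorems.PalmGoodLaw.ExactFrameC

end
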